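import Summits.CriticalPhenomena.SAWScalingLimit.Theorems.SAWDefectDecoherenceMassRatioFlatRootGlue
import Summits.CriticalPhenomena.SAWScalingLimit.Theorems.SAWDefectDecoherenceMassRatioSwapArcPositive

/-!
# Crux `SAWDefectDecoherence.MassRatio` (stmt-CriticalPhenomena-8550) — the TYPED SPLIT into three
# leaf sub-cruxes along the necessity seam (crux-strategist, wall-breaker pass p1)

The strategy census of this crux (`Cruxes/MassRatio/STRATEGY-CENSUS.md`) records that every line at the
filed cut `3/4` dies on the same residual: in the tame frame the crux is the exponent inequality
`q − p ≤ 3/4` between a certified boundary arrival exponent `q` (truth `2h_b = 5/4`) and a certified bulk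
mass exponent `p` (truth `h_b + x₁ = 35/48`), and no proof can avoid certifying both to within `11/48`
(`Cruxes/MassRatio/Ideator6Necessity.md`). This file lands the kernel-checked IMPLICATION from the three
sub-statements of the canonical (flat-root, arc-averaged) form of that seam to the crux BY NAME, so that
the route can carry them as leaf sub-cruxes (`route edit --split MassRatio`):

* `Sub₁ = ∀ ε > 0, RootSwapArc ε` — change of root (exponent `0`): the wild root `a_δ` is swapped for the
  door edges of the swap arc `S_δ` near the tame point `b` (SAW boundary quasi-multiplicativity; open,
  random-walk level);
* `Sub₂ = HalfDiscArcArrival (1/3)` — far-arc arrival from the tame root inside the lattice half-disc,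
  `Σ_{a'∈S_δ} Z_{H_δ}(b_δ → a') ≥ c₀ δ^{1/3}` (truth `δ^{1/4}`; rigorous today `δ^{1}`, DCS escape bound);
* `Sub₃ = ArcRootedBulkMass (2/5)` — arc-rooted normalised bulk mass `Σ_{a'∈S_δ} M_K(a') ≤ C δ^{-2/5}`
  (truth `δ^{-13/48}`; no polynomial bound of any exponent is known — the universal polynomial core).

Exponent bookkeeping: `2/5 + 1/3 = 11/15 < 3/4`, so `Glue.arcMassRatio_of_split` gives
`ArcMassRatio (11/15)` and `massRatio_of_flatRootStubs` (root swap at `ε = 3/4 − 11/15 = 1/60`, arc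
positivity LANDED as `ArcSwap.stub_swapArcPositive`) concludes `MassRatio`. The margins above the
Coulomb-gas truths are `1/3 − 1/4 = 1/12` (boundary) and `2/5 − 13/48 = 31/240` (bulk).

Two forms are proved: `MassRatio_of_subs` over the predicates of `…FlatRootDefs`, and
`MassRatio_of_children` over the three statements WRITTEN OUT over Literature declarations with the
crux frame curried (the exact text of the route's split children `RootSwapArcAll`,
`HalfDiscArcArrivalThird`, `ArcRootedBulkMassTwoFifths`), each delivered to the predicate form by
definitional unfolding. Sources: `…FlatRootDefs/Glue.lean` (p96567/p99446), `…SwapArcPositive.lean`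
(p96866); H. Duminil-Copin, S. Smirnov, Ann. of Math. 175 (2012) (arXiv:1007.0575) for the observable;
the necessity ledger and census in `Cruxes/MassRatio/`. Deliberately NOT here: any of the three
sub-statements (open).
-/

noncomputable section

namespace Summit.CriticalPhenomena.SAWScalingLimit.Theorems.MassRatio.FlatRoot

open Literature.Probability.LatticeModels Literature.Probability.RandomPlanarGeometry
open Literature.Probability.RandomPlanarGeometry.SAW
open Summit.CriticalPhenomena.SAWScalingLimit.Theses.SAWDefectDecoherence
open Summit.CriticalPhenomena.SAWScalingLimit.Theorems.MassRatio.Negative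
open Summit.CriticalPhenomena.SAWScalingLimit.Theorems.MassRatio.Renewal (Z)
open scoped Classical

namespace Split

/-- Arc positivity at every datum, in the predicate form of `…FlatRootDefs`, from the LANDED stub
`ArcSwap.stub_swapArcPositive` (p96866) by uncurrying the frame. [folklore] -/
theorem swapArcPositive_all :
    ∀ (D : DobrushinDomain) (ρ : ℝ) (Λ : ℝ → Finset HexVertex) (m : ℝ → ℤ)
      (a b : ℝ → Sym2 HexVertex), SwapArcPositive D ρ Λ m a b := by
  intro D ρ Λ m a b hF
  obtain ⟨hρ, hflat, hadm, hexh, ha, hb⟩ := hF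
  exact ArcSwap.stub_swapArcPositive D ρ Λ m a b hρ hflat hadm hexh ha hb

/-- **The typed split of the crux (predicate form).** Root swap for every `ε > 0`, far-arc arrival at
exponent `1/3` and arc-rooted bulk mass at exponent `2/5` imply `MassRatio`: `2/5 + 1/3 = 11/15 < 3/4`
(`Glue.arcMassRatio_of_split`, then `massRatio_of_flatRootStubs` with the landed arc positivity).
[folklore] -/
theorem MassRatio_of_subs (hR : ∀ ε : ℝ, 0 < ε → RootSwapArc ε)
    (hB : HalfDiscArcArrival (1 / 3)) (hA : ArcRootedBulkMass (2 / 5)) : MassRatio :=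
  massRatio_of_flatRootStubs hR
    ⟨11 / 15, by norm_num, Glue.arcMassRatio_of_split (A := 2 / 5) (B := 1 / 3) (by norm_num) hB hA⟩
    swapArcPositive_all

/-! ## The three children written out over Literature declarations (frame curried) -/

/-- Child 1 `RootSwapArcAll` (= `∀ ε > 0, RootSwapArc ε`, written out). [folklore] -/
def RootSwapArcAllStmt : Prop :=
  ∀ ε : ℝ, 0 < ε →
    ∀ (D : DobrushinDomain) (ρ : ℝ) (Λ : ℝ → Finset HexVertex) (m : ℝ → ℤ)
      (a b : ℝ → Sym2 HexVertex),
      0 < ρ →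
      D.carrier ∩ Metric.ball (D.pt 1) ρ = {z : ℂ | (D.pt 1).im < z.im} ∩ Metric.ball (D.pt 1) ρ →
      (∀ᶠ δ : ℝ in nhdsWithin 0 (Set.Ioi 0),
        hexDomainSimplyConnected (Λ δ) ∧ a δ ∈ hexDomainBoundary (Λ δ) ∧
          b δ ∈ hexDomainBoundary (Λ δ) ∧ Nonempty (HexMidEdgeSAW (Λ δ) (a δ) (b δ)) ∧
          (hexGraph.induce ((Λ δ : Finset HexVertex) : Set HexVertex)).Preconnected ∧
          (∀ v ∈ Λ δ, (δ : ℂ) * hexCenter v ∈ D.carrier) ∧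
          (∀ v : HexVertex, (δ : ℂ) * hexCenter v ∈ Metric.ball (D.pt 1) ρ →
            (v ∈ Λ δ ↔ m δ ≤ v.1 1))) →
      (∀ K : Set ℂ, IsCompact K → K ⊆ D.carrier → ∀ᶠ δ : ℝ in nhdsWithin 0 (Set.Ioi 0),
        ∀ v : HexVertex, (δ : ℂ) * hexCenter v ∈ K → v ∈ Λ δ) →
      Filter.Tendsto (fun δ : ℝ => (δ : ℂ) * hexMidpoint (a δ)) (nhdsWithin 0 (Set.Ioi 0))
        (nhds (D.pt 0)) →
      Filter.Tendsto (fun δ : ℝ => (δ : ℂ) * hexMidpoint (b δ)) (nhdsWithin 0 (Set.Ioi 0))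
        (nhds (D.pt 1)) →
      ∀ K : Set ℂ, IsCompact K → K ⊆ D.carrier → ∃ C : ℝ,
        ∀ᶠ δ : ℝ in nhdsWithin 0 (Set.Ioi 0),
          (δ ^ 2 * ∑ᶠ e ∈ {e : Sym2 HexVertex | e ∈ hexDomainMidEdges (Λ δ) ∧
              (δ : ℂ) * hexMidpoint e ∈ K},
              ‖hexParafermionicObservable (Λ δ) (a δ) hexCriticalFugacity 0 e‖) *
            (∑ᶠ a' ∈ {e : Sym2 HexVertex | e ∈ hexDomainBoundary (Λ δ) ∧
              ρ / 4 ≤ dist ((δ : ℂ) * hexMidpoint e) (D.pt 1) ∧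
              dist ((δ : ℂ) * hexMidpoint e) (D.pt 1) ≤ ρ / 2},
              ‖hexParafermionicObservable (Λ δ) (b δ) hexCriticalFugacity 0 a'‖) ≤
          C * δ ^ (-ε) * ‖hexParafermionicObservable (Λ δ) (a δ) hexCriticalFugacity 0 (b δ)‖ *
            ∑ᶠ a' ∈ {e : Sym2 HexVertex | e ∈ hexDomainBoundary (Λ δ) ∧
              ρ / 4 ≤ dist ((δ : ℂ) * hexMidpoint e) (D.pt 1) ∧
              dist ((δ : ℂ) * hexMidpoint e) (D.pt 1) ≤ ρ / 2},
              (δ ^ 2 * ∑ᶠ e ∈ {e : Sym2 HexVertex | e ∈ hexDomainMidEdges (Λ δ) ∧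
                (δ : ℂ) * hexMidpoint e ∈ K},
                ‖hexParafermionicObservable (Λ δ) a' hexCriticalFugacity 0 e‖)

/-- Child 2 `HalfDiscArcArrivalThird` (= `HalfDiscArcArrival (1/3)`, written out): far-arc arrival from
the tame root `b_δ` inside the lattice half-disc `H_δ = {v ∈ Λ_δ : |δ c_v − b| < 3ρ/4}` is at least
`c₀ δ^{1/3}` eventually. [folklore] -/
def HalfDiscArcArrivalThirdStmt : Prop :=
  ∀ (D : DobrushinDomain) (ρ : ℝ) (Λ : ℝ → Finset HexVertex) (m : ℝ → ℤ)
    (a b : ℝ → Sym2 HexVertex),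
    0 < ρ →
    D.carrier ∩ Metric.ball (D.pt 1) ρ = {z : ℂ | (D.pt 1).im < z.im} ∩ Metric.ball (D.pt 1) ρ →
    (∀ᶠ δ : ℝ in nhdsWithin 0 (Set.Ioi 0),
      hexDomainSimplyConnected (Λ δ) ∧ a δ ∈ hexDomainBoundary (Λ δ) ∧
        b δ ∈ hexDomainBoundary (Λ δ) ∧ Nonempty (HexMidEdgeSAW (Λ δ) (a δ) (b δ)) ∧
        (hexGraph.induce ((Λ δ : Finset HexVertex) : Set HexVertex)).Preconnected ∧
        (∀ v ∈ Λ δ, (δ : ℂ) * hexCenter v ∈ D.carrier) ∧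
        (∀ v : HexVertex, (δ : ℂ) * hexCenter v ∈ Metric.ball (D.pt 1) ρ →
          (v ∈ Λ δ ↔ m δ ≤ v.1 1))) →
    (∀ K : Set ℂ, IsCompact K → K ⊆ D.carrier → ∀ᶠ δ : ℝ in nhdsWithin 0 (Set.Ioi 0),
      ∀ v : HexVertex, (δ : ℂ) * hexCenter v ∈ K → v ∈ Λ δ) →
    Filter.Tendsto (fun δ : ℝ => (δ : ℂ) * hexMidpoint (a δ)) (nhdsWithin 0 (Set.Ioi 0))
      (nhds (D.pt 0)) →
    Filter.Tendsto (fun δ : ℝ => (δ : ℂ) * hexMidpoint (b δ)) (nhdsWithin 0 (Set.Ioi 0))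
      (nhds (D.pt 1)) →
    ∃ c₀ : ℝ, 0 < c₀ ∧ ∀ᶠ δ : ℝ in nhdsWithin 0 (Set.Ioi 0),
      c₀ * δ ^ (1 / 3 : ℝ) ≤
        ∑ᶠ a' ∈ {e : Sym2 HexVertex | e ∈ hexDomainBoundary (Λ δ) ∧
          ρ / 4 ≤ dist ((δ : ℂ) * hexMidpoint e) (D.pt 1) ∧
          dist ((δ : ℂ) * hexMidpoint e) (D.pt 1) ≤ ρ / 2},
          ‖hexParafermionicObservable
              ((Λ δ).filter fun v => dist ((δ : ℂ) * hexCenter v) (D.pt 1) < 3 * ρ / 4)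
              (b δ) hexCriticalFugacity 0 a'‖

/-- Child 3 `ArcRootedBulkMassTwoFifths` (= `ArcRootedBulkMass (2/5)`, written out): the normalised
bulk `K`-mass summed over the roots of the swap arc is `≤ C δ^{-2/5}` eventually. [folklore] -/
def ArcRootedBulkMassTwoFifthsStmt : Prop :=
  ∀ (D : DobrushinDomain) (ρ : ℝ) (Λ : ℝ → Finset HexVertex) (m : ℝ → ℤ)
    (a b : ℝ → Sym2 HexVertex),
    0 < ρ →
    D.carrier ∩ Metric.ball (D.pt 1) ρ = {z : ℂ | (D.pt 1).im < z.im} ∩ Metric.ball (D.pt 1) ρ →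
    (∀ᶠ δ : ℝ in nhdsWithin 0 (Set.Ioi 0),
      hexDomainSimplyConnected (Λ δ) ∧ a δ ∈ hexDomainBoundary (Λ δ) ∧
        b δ ∈ hexDomainBoundary (Λ δ) ∧ Nonempty (HexMidEdgeSAW (Λ δ) (a δ) (b δ)) ∧
        (hexGraph.induce ((Λ δ : Finset HexVertex) : Set HexVertex)).Preconnected ∧
        (∀ v ∈ Λ δ, (δ : ℂ) * hexCenter v ∈ D.carrier) ∧
        (∀ v : HexVertex, (δ : ℂ) * hexCenter v ∈ Metric.ball (D.pt 1) ρ →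
          (v ∈ Λ δ ↔ m δ ≤ v.1 1))) →
    (∀ K : Set ℂ, IsCompact K → K ⊆ D.carrier → ∀ᶠ δ : ℝ in nhdsWithin 0 (Set.Ioi 0),
      ∀ v : HexVertex, (δ : ℂ) * hexCenter v ∈ K → v ∈ Λ δ) →
    Filter.Tendsto (fun δ : ℝ => (δ : ℂ) * hexMidpoint (a δ)) (nhdsWithin 0 (Set.Ioi 0))
      (nhds (D.pt 0)) →
    Filter.Tendsto (fun δ : ℝ => (δ : ℂ) * hexMidpoint (b δ)) (nhdsWithin 0 (Set.Ioi 0))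
      (nhds (D.pt 1)) →
    ∀ K : Set ℂ, IsCompact K → K ⊆ D.carrier → ∃ C : ℝ,
      ∀ᶠ δ : ℝ in nhdsWithin 0 (Set.Ioi 0),
        (∑ᶠ a' ∈ {e : Sym2 HexVertex | e ∈ hexDomainBoundary (Λ δ) ∧
            ρ / 4 ≤ dist ((δ : ℂ) * hexMidpoint e) (D.pt 1) ∧
            dist ((δ : ℂ) * hexMidpoint e) (D.pt 1) ≤ ρ / 2},
            (δ ^ 2 * ∑ᶠ e ∈ {e : Sym2 HexVertex | e ∈ hexDomainMidEdges (Λ δ) ∧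
              (δ : ℂ) * hexMidpoint e ∈ K},
              ‖hexParafermionicObservable (Λ δ) a' hexCriticalFugacity 0 e‖)) ≤
        C * δ ^ (-(2 / 5 : ℝ))

/-- Child 1 delivers `∀ ε > 0, RootSwapArc ε` (definitional unfolding of the frame, the swap arc,
`massK` and `Z`). [folklore] -/
theorem rootSwapArc_of_child (h : RootSwapArcAllStmt) : ∀ ε : ℝ, 0 < ε → RootSwapArc ε := by
  intro ε hε D ρ Λ m a b hF K hK hKD
  obtain ⟨hρ, hflat, hadm, hexh, ha, hb⟩ := hF
  exact h ε hε D ρ Λ m a b hρ hflat hadm hexh ha hb K hK hKD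

/-- Child 2 delivers `HalfDiscArcArrival (1/3)`. [folklore] -/
theorem halfDiscArcArrival_of_child (h : HalfDiscArcArrivalThirdStmt) :
    HalfDiscArcArrival (1 / 3) := by
  intro D ρ Λ m a b hF
  obtain ⟨hρ, hflat, hadm, hexh, ha, hb⟩ := hF
  exact h D ρ Λ m a b hρ hflat hadm hexh ha hb

/-- Child 3 delivers `ArcRootedBulkMass (2/5)`. [folklore] -/
theorem arcRootedBulkMass_of_child (h : ArcRootedBulkMassTwoFifthsStmt) :
    ArcRootedBulkMass (2 / 5) := by
  intro D ρ Λ m a b hF K hK hKD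
  obtain ⟨hρ, hflat, hadm, hexh, ha, hb⟩ := hF
  exact h D ρ Λ m a b hρ hflat hadm hexh ha hb K hK hKD

/-- **The typed split of the crux (route form)** — exactly the shape of the split's glue item
`RootSwapArcAll → HalfDiscArcArrivalThird → ArcRootedBulkMassTwoFifths → MassRatio` (children written
out). [folklore] -/
theorem MassRatio_of_children :
    RootSwapArcAllStmt → HalfDiscArcArrivalThirdStmt → ArcRootedBulkMassTwoFifthsStmt → MassRatio :=
  fun h₁ h₂ h₃ =>
    MassRatio_of_subs (rootSwapArc_of_child h₁) (halfDiscArcArrival_of_child h₂)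
      (arcRootedBulkMass_of_child h₃)

end Split

end Summit.CriticalPhenomena.SAWScalingLimit.Theorems.MassRatio.FlatRoot
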